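import Literature.AnabelianGeometry.SemiGraphs.PullbackFunctorComp
import Literature.AnabelianGeometry.SemiGraphs.DecompositionGroupGeneral
import Literature.AnabelianGeometry.SemiGraphs.CoveringOfObjectVertexAligned
import Literature.AnabelianGeometry.SemiGraphs.Coverticial

/-!
# Vertex alignment is stable under composition of finite étale coverings ([SemiAnbd] §2 p. 23, Rem. 2.2.1)

Mochizuki, *Semi-graphs of anabelioids*, Publ. RIMS **42** (2006) 221–322, §2: Definition 2.2 (i)
p. 23 (finite étale coverings `𝒢′ → 𝒢`), Remark 2.2.1 p. 24 ("the image of each `Π_v` … in `Π_𝒢` is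
equal to the stabilizer of a compatible system of vertices"), Remark 2.4.1 p. 26 (properties that pass
to finite étale coverings) and Remark 2.4.2 p. 26 (composites of 1-morphisms)
[cite: MochizukiSemiAnbd2006, Rem. 2.2.1 p.24].

PROOF-ONLY companion (abc-iut cell; no definition, no named fact).  The covering notion of record of
the tree is `Hom.IsFiniteEtaleCoveringGlobal` = local ∧ global ∧ branch-aligned ∧ VERTEX-ALIGNED
(`Hom.IsVertexAligned`, abc-iut-L6-d4, `FiniteEtaleCoveringVertexAligned.lean`); print's "easy
verification" that a composite of finite étale coverings is a finite étale covering (used in Rem. 2.4.1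
for the universally-sub-coverticial clause, FACT-LIST row F-1478 as reduced by
`CoverticialRemark241OfComp.lean`) therefore has one clause per conjunct.  This file proves the
vertex-alignment clause:

* `Hom.ι_comp_eq` — along a composite `𝒢″ → 𝒢′ → 𝒢` the homomorphism `ι : Π_{𝒢″} → Π_𝒢` of the
  predicate is the composite of the two `ι`'s (`Hom.pi1Map_comp_pullbackFunctor`);
* `Hom.isoWhiskerLeft_comp_pullbackFunctor` — transports of basepoints whiskered along a composite;
* `Hom.IsVertexAligned.comp` — **if `ψ : 𝒢″ → 𝒢′` and `φ : 𝒢′ → 𝒢` are vertex-aligned and `φ` is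
  globally the covering of some object of `B(𝒢)` (`Hom.IsGlobalCoveringOf`, supplying the
  injectivity of `Π_{𝒢′} → Π_𝒢` WITHOUT connectedness, abc-iut-w4-d071's
  `covering_decompositionGroup_of_isGlobalCoveringOf`), then `ψ.comp φ` is vertex-aligned**;
* `Hom.IsFiniteEtaleCoveringGlobal.isVertexAligned_comp` — in particular for two finite étale
  coverings in print's sense.

Nothing here takes a side on [IUTchIII] Cor. 3.12.
-/

namespace Literature.AnabelianGeometry.SemiGraphs

open CategoryTheory CategoryTheory.PreGaloisCategory
open Literature.AnabelianGeometry.Anabelioids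
open scoped Pointwise

universe v₁ u₁ u

namespace SemiGraphOfAnabelioids

namespace Hom

variable {𝒢 𝒢' 𝒢'' : SemiGraphOfAnabelioids.{v₁, u₁, u}} (ψ : Hom 𝒢'' 𝒢') (φ : Hom 𝒢' 𝒢)

/-! ### Bookkeeping along a composite -/

/-- Transports of basepoints of `B(𝒢″)` whiskered along a composite: `(φ ∘ ψ)^* ◁ α = φ^* ◁ (ψ^* ◁ α)`
(the two pull-back functors `(ψ.comp φ)^*` and `φ^* ⋙ ψ^*` agree, `Hom.pullbackFunctor_comp`).
[cite: MochizukiSemiAnbd2006, Rem. 2.11.1 p.32] -/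
theorem isoWhiskerLeft_comp_pullbackFunctor {v₁'' v₂'' : 𝒢''.graph.Vertex}
    {F₁ : 𝒢''.V v₁'' ⥤ FintypeCat.{v₁}} {F₂ : 𝒢''.V v₂'' ⥤ FintypeCat.{v₁}}
    (α : 𝒢''.ρ v₁'' ⋙ F₁ ≅ 𝒢''.ρ v₂'' ⋙ F₂) :
    Functor.isoWhiskerLeft (ψ.comp φ).pullbackFunctor α =
      (Functor.isoWhiskerLeft φ.pullbackFunctor (Functor.isoWhiskerLeft ψ.pullbackFunctor α) :
        φ.pullbackFunctor ⋙ ψ.pullbackFunctor ⋙ 𝒢''.ρ v₁'' ⋙ F₁ ≅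
          φ.pullbackFunctor ⋙ ψ.pullbackFunctor ⋙ 𝒢''.ρ v₂'' ⋙ F₂) := by
  refine Iso.ext (NatTrans.ext (funext fun X => ?_))
  change α.hom.app ((ψ.comp φ).pullbackObj X) = α.hom.app (ψ.pullbackObj (φ.pullbackObj X))
  exact eq_of_heq (congr_arg_heq (fun Y => α.hom.app Y) (ψ.pullbackObj_comp φ X))

/-- Conjugation by the whiskering of an identity isomorphism of basepoints is the identity.
[cite: MochizukiGeoAn2004, Def. 1.1.2(ii) p.10] -/
theorem autMulEquivOfIso_isoWhiskerLeft_refl {C D : Type*} [Category C] [Category D] (R : C ⥤ D)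
    (G : D ⥤ FintypeCat.{v₁}) (y : Aut (R ⋙ G)) :
    Aut.autMulEquivOfIso (Functor.isoWhiskerLeft R (Iso.refl G)) y = y := by
  apply Iso.ext
  simp only [autMulEquivOfIso_hom, Functor.isoWhiskerLeft_inv, Functor.isoWhiskerLeft_hom,
    Iso.refl_inv, Iso.refl_hom, Functor.whiskerLeft_id', Category.id_comp, Category.comp_id]

/-- **`ι` of a composite is the composite of the `ι`'s.**  For the basepoint of `B(𝒢″)` through `v″`
(`F″`), the induced basepoint `F′ := ψ_{v″}^* ⋙ F″` of `𝒢′_{ψ v″}` and a basepoint `F` of `𝒢_v`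
identified by `e : (φ ∘ ψ)_{v″}^* ⋙ F″ = φ_{v′}^* ⋙ F′ ≅ F`, the homomorphism
`ι_{φψ} = Aut(ρ_v ◁ e) ∘ π₁((φ ∘ ψ)^*) : Π_{𝒢″} → Π_𝒢` of the vertex-alignment predicate equals
`ι_φ ∘ ι_ψ` with `ι_ψ = π₁(ψ^*)` (identity identification) and `ι_φ = Aut(ρ_v ◁ e) ∘ π₁(φ^*)`.
[cite: MochizukiSemiAnbd2006, Rem. 2.2.1 p.24] -/
theorem ι_comp_eq (v'' : 𝒢''.graph.Vertex) (F'' : 𝒢''.V v'' ⥤ FintypeCat.{v₁})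
    (F : 𝒢.V (φ.base.vertexMap (ψ.base.vertexMap v'')) ⥤ FintypeCat.{v₁})
    (e : (φ.φV (ψ.base.vertexMap v'')).pullback ⋙ (ψ.φV v'').pullback ⋙ F'' ≅ F) :
    (Aut.autMulEquivOfIso (Functor.isoWhiskerLeft (𝒢.ρ (φ.base.vertexMap (ψ.base.vertexMap v''))) e)
        ).toMonoidHom.comp (pi1Map (ψ.comp φ).pullbackFunctor (𝒢''.ρ v'' ⋙ F'')) =
      ((Aut.autMulEquivOfIso
          (Functor.isoWhiskerLeft (𝒢.ρ (φ.base.vertexMap (ψ.base.vertexMap v''))) e)).toMonoidHom.comp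
        (pi1Map φ.pullbackFunctor (𝒢'.ρ (ψ.base.vertexMap v'') ⋙ (ψ.φV v'').pullback ⋙ F''))).comp
      (pi1Map ψ.pullbackFunctor (𝒢''.ρ v'' ⋙ F'')) := by
  refine MonoidHom.ext fun σ => ?_
  exact congrArg (Aut.autMulEquivOfIso
    (Functor.isoWhiskerLeft (𝒢.ρ (φ.base.vertexMap (ψ.base.vertexMap v''))) e))
    (ψ.pi1Map_comp_pullbackFunctor_apply φ v'' F'' σ)

end Hom

/-! ### The clause -/

namespace Hom

variable {𝒢 𝒢' 𝒢'' : SemiGraphOfAnabelioids.{v₁, u₁, u}} {ψ : Hom 𝒢'' 𝒢'} {φ : Hom 𝒢' 𝒢}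

/-- A subgroup-lattice identity used twice below: if `K ≤ L` then `K ⊓ (L ⊓ M) = K ⊓ M`. [folklore] -/
private theorem inf_inf_of_le {G : Type*} [Group G] {K L M : Subgroup G} (h : K ≤ L) :
    K ⊓ (L ⊓ M) = K ⊓ M := by
  rw [← inf_assoc, inf_eq_left.mpr h]

/-- **Vertex alignment is stable under composition.**  Let `ψ : 𝒢″ → 𝒢′` and `φ : 𝒢′ → 𝒢` be
vertex-aligned, and let `φ` be GLOBALLY the covering attached to some `A ∈ B(𝒢)` (so that
`ι_φ : Π_{𝒢′} → Π_𝒢` is injective at every basepoint — [SemiAnbd] Rem. 2.2.1, abc-iut-w4-d071's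
`covering_decompositionGroup_of_isGlobalCoveringOf`, no connectedness needed).  Then `φ ∘ ψ` is
vertex-aligned: with `ι_{φψ} = ι_φ ∘ ι_ψ` (`ι_comp_eq`),
(a) `ι_{φψ}(Π_{v″}) = ι_φ(ι_ψ(Π_{v″})) = ι_φ(Π′_ψ ∩ Π_{v′}) = ι_φ(Π′_ψ) ∩ ι_φ(Π_{v′}) = Π″ ∩ (Π′ ∩ Πv) = Π″ ∩ Πv`
(injectivity of `ι_φ`; (a) for `ψ` at `v″` and for `φ` at `v′ = ψ v″`);
(b) for `v‴` over `v` with transport `α` in `B(𝒢″)`: `ι_{φψ} ∘ conj_α = ι_φ ∘ conj_{ψ^* α} ∘ π₁(ψ^*)`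
at the base vertex `v‴` (naturality of `π₁` under conjugation, `(φψ)^* ◁ α = φ^* ◁ ψ^* ◁ α`), so the
verticial subgroup of `v‴` read in `Π_𝒢` is `ι_φ conj_{ψ^*α}(Π′_ψ(v‴) ∩ Π_{ψ v‴})`
((a) for `ψ` at the base vertex `v‴`) `= Π″ ∩ ι_φ conj_{ψ^* α}(Π_{ψ v‴}) = Π″ ∩ (Π′ ∩ g⁻¹ Πv g)`
((b) for `φ`, the vertex `ψ v‴` over `v`, transport `ψ^* α`) `= Π″ ∩ g⁻¹ Πv g`.
[cite: MochizukiSemiAnbd2006, Rem. 2.2.1 p.24] -/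
theorem IsVertexAligned.comp (hψ : ψ.IsVertexAligned) (hφ : φ.IsVertexAligned)
    (hφG : ∃ A : 𝒢.BObj, φ.IsGlobalCoveringOf A) : (ψ.comp φ).IsVertexAligned := by
  intro v'' F'' _ F _ e
  -- notation
  let v' : 𝒢'.graph.Vertex := ψ.base.vertexMap v''
  let v : 𝒢.graph.Vertex := φ.base.vertexMap v'
  let F' : 𝒢'.V v' ⥤ FintypeCat.{v₁} := (ψ.φV v'').pullback ⋙ F''
  haveI : FiberFunctor F' := fiberFunctor_comp_of_exact _ F''
  -- the homomorphisms `ι`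
  let eχ : (ψ.comp φ).pullbackFunctor ⋙ 𝒢''.ρ v'' ⋙ F'' ≅ 𝒢.ρ v ⋙ F :=
    Functor.isoWhiskerLeft (𝒢.ρ v) e
  let ιχ : 𝒢''.Pi v'' F'' →* 𝒢.Pi v F :=
    (Aut.autMulEquivOfIso eχ).toMonoidHom.comp (pi1Map (ψ.comp φ).pullbackFunctor (𝒢''.ρ v'' ⋙ F''))
  let ιφ : 𝒢'.Pi v' F' →* 𝒢.Pi v F :=
    (Aut.autMulEquivOfIso (Functor.isoWhiskerLeft (𝒢.ρ v) e)).toMonoidHom.comp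
      (pi1Map φ.pullbackFunctor (𝒢'.ρ v' ⋙ F'))
  let ιψ₀ : 𝒢''.Pi v'' F'' →* 𝒢'.Pi v' F' := pi1Map ψ.pullbackFunctor (𝒢''.ρ v'' ⋙ F'')
  let ιψ : 𝒢''.Pi v'' F'' →* 𝒢'.Pi v' F' :=
    (Aut.autMulEquivOfIso (Functor.isoWhiskerLeft (𝒢'.ρ v') (Iso.refl F'))).toMonoidHom.comp ιψ₀
  have hιψ : ιψ = ιψ₀ := by
    ext σ : 1
    exact autMulEquivOfIso_isoWhiskerLeft_refl _ _ _
  have hιχ : ιχ = ιφ.comp ιψ₀ := ψ.ι_comp_eq φ v'' F'' F e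
  let Pv : Subgroup (𝒢.Pi v F) := (𝒢.piVToPi v F).range
  let P'v' : Subgroup (𝒢'.Pi v' F') := (𝒢'.piVToPi v' F').range
  -- the clauses of `ψ` at `v″` (identity identification) and of `φ` at `v′`
  obtain ⟨haψ, -⟩ := hψ v'' F'' F' (Iso.refl F')
  obtain ⟨haφ, hbφ⟩ := @hφ v' F' _ F ‹_› e
  change (ιψ.comp (𝒢''.piVToPi v'' F'')).range = ιψ.range ⊓ P'v' at haψ
  change (ιφ.comp (𝒢'.piVToPi v' F')).range = ιφ.range ⊓ Pv at haφ
  rw [hιψ] at haψ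
  -- injectivity of `ι_φ`
  obtain ⟨A, hA⟩ := hφG
  obtain ⟨-, hinj, -⟩ := covering_decompositionGroup_of_isGlobalCoveringOf φ A hA v' F' F e
  change Function.Injective ιφ at hinj
  have hle' : (ιφ.comp ιψ₀).range ≤ ιφ.range := by
    rw [MonoidHom.range_comp]; exact Subgroup.map_le_range _ _
  have hle : ιχ.range ≤ ιφ.range := hιχ ▸ hle'
  refine ⟨?_, ?_⟩
  · -- (a)
    change (ιχ.comp (𝒢''.piVToPi v'' F'')).range = ιχ.range ⊓ Pv
    rw [hιχ, MonoidHom.comp_assoc, MonoidHom.range_comp, haψ, Subgroup.map_inf_eq _ _ _ hinj,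
      ← MonoidHom.range_comp, ← MonoidHom.range_comp, haφ, inf_inf_of_le hle']
  · -- (b)
    intro v''' F''' _ α
    -- the base vertex `v‴` of `𝒢″`, its image `v′₁` in `𝒢′`, the induced basepoint `F′₁`
    let v'₁ : 𝒢'.graph.Vertex := ψ.base.vertexMap v'''.1
    have hv'₁ : φ.base.vertexMap v'₁ = v := v'''.2
    let F'₁ : 𝒢'.V v'₁ ⥤ FintypeCat.{v₁} := (ψ.φV v'''.1).pullback ⋙ F'''
    haveI : FiberFunctor F'₁ := fiberFunctor_comp_of_exact _ F'''
    -- (a) for `ψ` at the base vertex `v‴`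
    obtain ⟨haψ₁, -⟩ := hψ v'''.1 F''' F'₁ (Iso.refl F'₁)
    let ιψ₁ : 𝒢''.Pi v'''.1 F''' →* 𝒢'.Pi v'₁ F'₁ :=
      pi1Map ψ.pullbackFunctor (𝒢''.ρ v'''.1 ⋙ F''')
    have hιψ₁ : (Aut.autMulEquivOfIso (Functor.isoWhiskerLeft (𝒢'.ρ v'₁) (Iso.refl F'₁))
        ).toMonoidHom.comp (pi1Map ψ.pullbackFunctor (𝒢''.ρ v'''.1 ⋙ F''')) = ιψ₁ := by
      ext σ : 1
      exact autMulEquivOfIso_isoWhiskerLeft_refl _ _ _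
    change ((Aut.autMulEquivOfIso (Functor.isoWhiskerLeft (𝒢'.ρ v'₁) (Iso.refl F'₁))
        ).toMonoidHom.comp (pi1Map ψ.pullbackFunctor (𝒢''.ρ v'''.1 ⋙ F''')) |>.comp
        (𝒢''.piVToPi v'''.1 F''')).range = _ ⊓ (𝒢'.piVToPi v'₁ F'₁).range at haψ₁
    rw [hιψ₁] at haψ₁
    -- the transport `ψ^* ◁ α` of basepoints of `B(𝒢′)` and (b) for `φ` at the vertex `v′₁` over `v`
    let α' : 𝒢'.ρ v'₁ ⋙ F'₁ ≅ 𝒢'.ρ v' ⋙ F' := Functor.isoWhiskerLeft ψ.pullbackFunctor α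
    obtain ⟨g, hg⟩ := hbφ ⟨v'₁, hv'₁⟩ F'₁ α'
    refine ⟨g, ?_⟩
    change (ιφ.comp ((Aut.autMulEquivOfIso α').toMonoidHom.comp (𝒢'.piVToPi v'₁ F'₁))).range =
      ιφ.range ⊓ ConjAct.toConjAct g⁻¹ • Pv at hg
    change (ιχ.comp ((Aut.autMulEquivOfIso α).toMonoidHom.comp (𝒢''.piVToPi v'''.1 F'''))).range =
      ιχ.range ⊓ ConjAct.toConjAct g⁻¹ • Pv
    -- `ι_{φψ} ∘ conj_α = ι_φ ∘ conj_{α′} ∘ π₁(ψ^*)` at the base vertex `v‴`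
    have key : ιχ.comp (Aut.autMulEquivOfIso α).toMonoidHom =
        (ιφ.comp (Aut.autMulEquivOfIso α').toMonoidHom).comp ιψ₁ := by
      refine MonoidHom.ext fun σ => ?_
      change Aut.autMulEquivOfIso eχ
          (pi1Map (ψ.comp φ).pullbackFunctor (𝒢''.ρ v'' ⋙ F'') (Aut.autMulEquivOfIso α σ)) =
        Aut.autMulEquivOfIso eχ (pi1Map φ.pullbackFunctor (𝒢'.ρ v' ⋙ F')
          (Aut.autMulEquivOfIso α' (pi1Map ψ.pullbackFunctor (𝒢''.ρ v'''.1 ⋙ F''') σ)))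
      refine congrArg (Aut.autMulEquivOfIso eχ) ?_
      -- `π₁((φψ)^*)(conj_α σ) = conj_{(φψ)^* α} (π₁((φψ)^*) σ)`
      have h1 := (autMulEquivOfIso_whiskerLeft_pi1Map (ψ.comp φ).pullbackFunctor α σ).symm
      -- `π₁((φψ)^*) σ = π₁(φ^*) (π₁(ψ^*) σ)` at the base vertex `v‴`
      have h2 := congrArg (Aut.autMulEquivOfIso (Functor.isoWhiskerLeft (ψ.comp φ).pullbackFunctor α))
        (ψ.pi1Map_comp_pullbackFunctor_apply φ v'''.1 F''' σ)
      -- `(φψ)^* ◁ α = φ^* ◁ (ψ^* ◁ α)`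
      have h3 := congrArg (fun i => Aut.autMulEquivOfIso i
          (pi1Map φ.pullbackFunctor (ψ.pullbackFunctor ⋙ 𝒢''.ρ v'''.1 ⋙ F''')
            (pi1Map ψ.pullbackFunctor (𝒢''.ρ v'''.1 ⋙ F''') σ)))
        (ψ.isoWhiskerLeft_comp_pullbackFunctor φ α)
      -- `conj_{φ^* ◁ α′} ∘ π₁(φ^*) = π₁(φ^*) ∘ conj_{α′}`
      have h4 := autMulEquivOfIso_whiskerLeft_pi1Map φ.pullbackFunctor
        (Functor.isoWhiskerLeft ψ.pullbackFunctor α)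
        (pi1Map ψ.pullbackFunctor (𝒢''.ρ v'''.1 ⋙ F''') σ)
      exact ((h1.trans h2).trans h3).trans h4
    have hsurj : (Aut.autMulEquivOfIso α).toMonoidHom.range = ⊤ :=
      MonoidHom.range_eq_top.mpr (Aut.autMulEquivOfIso α).surjective
    have hrange : (ιχ.comp (Aut.autMulEquivOfIso α).toMonoidHom).range = ιχ.range := by
      rw [MonoidHom.range_comp, hsurj, ← MonoidHom.range_eq_map]
    have hinj' : Function.Injective (ιφ.comp (Aut.autMulEquivOfIso α').toMonoidHom) :=
      hinj.comp (Aut.autMulEquivOfIso α').injective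
    rw [← MonoidHom.comp_assoc, key, MonoidHom.comp_assoc, MonoidHom.range_comp, haψ₁,
      Subgroup.map_inf_eq _ _ _ hinj', ← MonoidHom.range_comp, ← MonoidHom.range_comp, ← key, hrange,
      MonoidHom.comp_assoc, hg, inf_inf_of_le hle]

/-- **A composite of two finite étale coverings (print's sense) is vertex-aligned.**
[cite: MochizukiSemiAnbd2006, Rem. 2.2.1 p.24] -/
theorem IsFiniteEtaleCoveringGlobal.isVertexAligned_comp (hψ : ψ.IsFiniteEtaleCoveringGlobal)
    (hφ : φ.IsFiniteEtaleCoveringGlobal) : (ψ.comp φ).IsVertexAligned := by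
  obtain ⟨_, -, -, -, hψV⟩ := hψ
  obtain ⟨A, -, hG, -, hφV⟩ := hφ
  exact hψV.comp hφV ⟨A, hG⟩

end Hom

end SemiGraphOfAnabelioids

end Literature.AnabelianGeometry.SemiGraphs
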